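import Summits.Langlands.Langlands.Theses.G2ShadowRankSeven

/-!
# Route `G2ShadowRankSeven` (Langlands) — assembly item `Assembly` (stmt-Langlands-18292)

Settles the assembly item of the thin route `G2ShadowRankSeven`:

  `Assembly := NoShadowLineAdmissible → LineOrIrreducibleAdmissible → GenericWeightCofinite →
    RankSevenToLanglands → Langlands`.

This is pure logic (D-0019 thin route): the three cells

* `A = NoShadowLineAdmissible` (on the G₂-admissible weight locus: cofinitely in `ℓ`, no compatible
  framed avatar has a one-dimensional subquotient),
* `B = LineOrIrreducibleAdmissible` (on the locus: cofinitely in `ℓ`, every compatible framed avatar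
  is irreducible or has a one-dimensional subquotient),
* `C = GenericWeightCofinite` (off the locus: cofinite irreducibility),

assemble to the target `RankSevenCofinite` by the weight dichotomy (`by_cases` on the G₂-admissible
shape of the infinity type; on the locus the two finite exceptional sets of primes are united and `A`
removes the second disjunct of `B`), and the residual `J = RankSevenToLanglands : RankSevenCofinite →
Langlands` finishes.  The closing theorem is stated against the route decl BY NAME so that the gate
can close the item; no mathematical content lives here — the content of the route is in the cruxes
`NoShadowLineAdmissible` (rank 2), `LineOrIrreducibleAdmissible` (rank 3), `GenericWeightCofinite`
(rank 4) and the residual support `RankSevenToLanglands` (rank 9).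
-/

namespace Summit.Langlands.Langlands.Theorems.G2ShadowRankSeven

open Summit.Langlands.Langlands.Theses.G2ShadowRankSeven

/-- **The three cells give the target** (route G2ShadowRankSeven, weight dichotomy).
`NoShadowLineAdmissible → LineOrIrreducibleAdmissible → GenericWeightCofinite → RankSevenCofinite`:
fix `π`, `T` and the essential self-duality datum; if the infinity type `T` is G₂-admissible at every
embedding, `B` yields a finite set `S_B` beyond which every compatible avatar is irreducible or has a
line subquotient and `A` a finite set `S_A` beyond which no avatar has a line subquotient, so beyond
`S_A ∪ S_B` every avatar is irreducible; otherwise `C` applies verbatim. [folklore] -/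
theorem rankSevenCofinite_of_cells (hA : NoShadowLineAdmissible) (hB : LineOrIrreducibleAdmissible)
    (hC : GenericWeightCofinite) : RankSevenCofinite := by
  intro hcpt π T hT hreg halg hsd
  by_cases hadm : ∀ σ : ℚ →+* ℂ, ∃ c p q : ℂ,
      (T σ).map Literature.NumberTheory.Automorphic.ArchWeight.a =
        {c, c + p, c - p, c + q, c - q, c + (p + q), c - (p + q)}
  · obtain ⟨SA, hSA⟩ := hA hcpt π T hT hreg halg hsd hadm
    obtain ⟨SB, hSB⟩ := hB hcpt π T hT hreg halg hsd hadm
    refine ⟨SA ∪ SB, ?_⟩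
    intro ℓ _ hℓ ι ρ hρ
    have hℓA : ℓ ∉ SA := fun h => hℓ (Finset.mem_union_left _ h)
    have hℓB : ℓ ∉ SB := fun h => hℓ (Finset.mem_union_right _ h)
    rcases hSB ℓ hℓB ι ρ hρ with hirr | hline
    · exact hirr
    · exact absurd hline (hSA ℓ hℓA ι ρ hρ)
  · exact hC hcpt π T hT hreg halg hsd hadm

/-- **Assembly of route G2ShadowRankSeven** (item stmt-Langlands-18292).
`NoShadowLineAdmissible → LineOrIrreducibleAdmissible → GenericWeightCofinite →
RankSevenToLanglands → Langlands`: unfold `Assembly`; the three cells give `RankSevenCofinite`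
(`rankSevenCofinite_of_cells`, the weight dichotomy) and the residual `RankSevenToLanglands` maps it
to `Langlands`. [folklore] -/
theorem Assembly_proof : Summit.Langlands.Langlands.Theses.G2ShadowRankSeven.Assembly := by
  unfold Summit.Langlands.Langlands.Theses.G2ShadowRankSeven.Assembly
  intro hA hB hC hJ
  exact hJ (rankSevenCofinite_of_cells hA hB hC)

end Summit.Langlands.Langlands.Theorems.G2ShadowRankSeven
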